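import Summits.ResolutionOfSingularities.ResolutionOfSingularities.Theorems.UniformComplexityPrimeModelTransferSpecializationLemmas
import Summits.ResolutionOfSingularities.ResolutionOfSingularities.Theorems.UniversalCellsProductDescentFibreGenericPoint
import Literature.AlgebraicGeometry.Limits.SubalgebraSpread
import Literature.AlgebraicGeometry.Limits.LocalizationProperSpread
import Literature.AlgebraicGeometry.Limits.LocalizationSmoothSpread
import Literature.AlgebraicGeometry.Limits.GenericProperCover
import Literature.AlgebraicGeometry.Limits.GenericSmoothnessSpread
import Literature.AlgebraicGeometry.Motives.GeometricallyIntegralAlgClosed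
import Literature.AlgebraicGeometry.Resolution.SmoothOfRegularPerfectField
import Literature.AlgebraicGeometry.Resolution.SmoothStalksRegular
import Literature.AlgebraicGeometry.Morphisms.ReducedOfFlat
import Mathlib.AlgebraicGeometry.Morphisms.LocalFlatDescent
import HarnessLib

/-!
# Crux `PrimeModelTransfer` (stmt-ResolutionOfSingularities-8933), door 2 of slot W8.2:
# SPECIALIZATION OF RESOLUTIONS — the downward prime-model transfer is a theorem

Route `ResolutionOfSingularities/UniformComplexity`, crux `PrimeModelTransfer` (for a prime `p`:
resolution of integral separated finite-type schemes over the algebraically closed fields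
ALGEBRAIC over `𝔽_p` ⇒ the same over EVERY algebraically closed field of characteristic `p`). The
route thesis reads the crux model-theoretically ("prime model ⇒ all models", compactness /
uniformity). This file proves the CONVERSE direction unconditionally:

* `hasResolution_of_isProper_of_integralResOver_extension` — for `K` algebraically closed,
  `L ⊇ K` a PERFECT field over which all integral separated finite-type schemes are resolvable,
  every integral `X` PROPER over `K` has a resolution;
* `integralResOver_of_integralResOver_extension` — hence (Nagata, previous file) every integral
  separated finite-type `K`-scheme has one: **`Res(L) ⇒ Res(K)` for `K = K̄ ⊆ L`, `L` perfect**;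
* `integralResOver_subfield_of_integralResOver_subfield` — in particular the door-2 residual
  ladder is MONOTONE: inside an algebraically closed `K`, for algebraically closed subfields
  `M₁ ≤ M₂`, `Res(M₂) ⇒ Res(M₁)` (e.g. `R_{n+1} ⇒ R_n` for `R_n := Res((𝔽_p(t₁,…,t_n))^{alg})`,
  the fields of `Theorems/UniformComplexityPrimeModelTransferAlgClosureFgTower.lean`).

PROOF (the "Lefschetz principle" direction, EGA IV₃ §8 + IV₄ 17.7.8, assembled from the tree):
see the docstring of `hasResolution_of_isProper_of_integralResOver_extension`. Perfectness of
`L` is essential (regular ≠ smooth over imperfect `L`: barrier `RegularNotGeometricallyRegular`);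
no resolution is base-changed along an inseparable extension — the only base changes are along
`K ⊆ L`, `K ⊆ R`, `R → κ(a) = K`, of SMOOTH models. By-name consequences for door 2 (the crux
as a ONE-STEP climb between ALGEBRAICALLY CLOSED fields; `Res(𝔽̄_p)` from `Res(M)` for any
algebraically closed `M`) are in `Theorems/UniformComplexityCampaignW82SpecializationLinks.lean`.

[OURS · LADDER-RESOLUTION L1, slot W8.2 (prime-field / universality transfer), door 2
UniformComplexity] Theorems over the summit's own route; NOT statements of, and attributing
nothing to, Hironaka's 2017 manuscript. AI-written; weaker than expert review.

Sources: EGA IV₃ (1966) Thm. 8.8.2, 8.10.5, EGA IV₄ (1967) Prop. 17.7.8; The Stacks Project,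
Tags 01ZM, 081F, 0C0C, 02L4. [cite: EGAIV3, Thm. 8.10.5] [cite: StacksProject, Tag 081F]
-/

noncomputable section

set_option linter.dupNamespace false -- mandated namespace of this single-conjunct summit

open CategoryTheory CategoryTheory.Limits AlgebraicGeometry TopologicalSpace
open Literature.AlgebraicGeometry.Resolution

namespace Summit.ResolutionOfSingularities.ResolutionOfSingularities.Theorems.PrimeModelTransfer

open MonoidalCategory CartesianMonoidalCategory
open Literature.AlgebraicGeometry.Limits Literature.AlgebraicGeometry.Limits.LocApprox
open Literature.AlgebraicGeometry.Motives (SchemeOver specOver)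

set_option backward.isDefEq.respectTransparency false

/-- Over a locally Noetherian base, locally of finite type implies locally of finite
presentation. [folklore] -/
private theorem locallyOfFinitePresentation_of_isLocallyNoetherian' {Y T : Scheme.{0}} (q : Y ⟶ T)
    [LocallyOfFiniteType q] [IsLocallyNoetherian T] : LocallyOfFinitePresentation q := by
  rw [HasRingHomProperty.iff_appLE (P := @LocallyOfFinitePresentation)]
  intro U V e
  haveI := IsLocallyNoetherian.component_noetherian (X := T) U
  exact RingHom.FinitePresentation.of_finiteType.mp
    (HasRingHomProperty.appLE @LocallyOfFiniteType q inferInstance U V e)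

/-- **SPECIALIZATION OF RESOLUTIONS, proper case.** Let `K` be algebraically closed, `L ⊇ K` a
perfect field over which every integral separated scheme of finite type has a resolution, and
`X → Spec K` proper with `X` integral. Then `X` has a resolution. Proof: `X_L := X ×_K L` is
integral (`K` algebraically closed) and proper over `L`; a resolution `π : Y → X_L` has `Y`
smooth and proper over the perfect `L`; `π` spreads out to a separated finite-type
`G : Y_R → X_R := X ×_K Spec R` over a finitely generated `K`-subalgebra `R ⊆ L`
(`Limits.exists_isPullback_whisker_of_hom_tensorObj`); over `F = Frac R` the structure map
`Y_F → Spec F` is smooth and proper by fpqc descent from `L`, hence so is `Y ×_R R[1/t] → Spec R[1/t]`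
for some `t ≠ 0` (`LocApprox.exists_forall_smooth_snd`, Chow cover `exists_proper_generic_cover` +
`isProper_snd_of_generic_cover`); `G` is an isomorphism over a non-empty open `W ⊆ X_R` (it is
one at the generic point by descent from `π`); at a `K`-rational closed point `a ∈ D(t)` in the
(open) image of `W`, the fibre `Y_a → X_a ≅ X` is proper, from a regular (smooth over `κ(a) = K`)
Noetherian scheme, and an isomorphism over the non-empty open `W_a`, whence a resolution of `X`
(`hasResolution_of_isIso_morphismRestrict`). [cite: EGAIV3, Thm. 8.10.5] -/
theorem hasResolution_of_isProper_of_integralResOver_extension (K : Type) [Field K] [IsAlgClosed K]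
    (L : Type) [Field L] [Algebra K L] [PerfectField L]
    (hL : ∀ (X : Scheme.{0}) (f : X ⟶ Spec (.of L)), IsSeparated f → LocallyOfFiniteType f →
      QuasiCompact f → IsIntegral X → Scheme.HasResolution X)
    (X : Scheme.{0}) (f : X ⟶ Spec (.of K)) [IsProper f] [IsIntegral X] :
    Scheme.HasResolution X := by
  classical
  -- ### Step 1: `X_L = X ×_K Spec L` is integral and proper over `L`
  let X₀ : SchemeOver K := Over.mk f
  haveI : IsProper X₀.hom := ‹IsProper f›
  haveI : QuasiCompact X₀.hom := inferInstance
  haveI : IsSeparated X₀.hom := inferInstance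
  haveI : LocallyOfFinitePresentation X₀.hom := locallyOfFinitePresentation_of_isLocallyNoetherian' f
  let XL : Scheme.{0} := (X₀ ⊗ specOver K L).left
  let fstL : XL ⟶ X := pullback.fst X₀.hom (specOver K L).hom
  let fL : XL ⟶ Spec (.of L) := pullback.snd X₀.hom (specOver K L).hom
  have hGI : GeometricallyIntegral f :=
    Literature.AlgebraicGeometry.Motives.geometricallyIntegral_of_isAlgClosed (k := K) f
  haveI : IsIntegral XL :=
    hGI.geometrically_isIntegral (specOver K L).hom fstL fL (IsPullback.of_hasPullback _ _)
  haveI : IsProper fL := inferInstance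
  -- ### Step 2: a resolution of `X_L`; its source is integral, smooth and proper over `L`
  obtain ⟨Y, π, hres⟩ := hL XL fL inferInstance inferInstance inferInstance inferInstance
  haveI := hres.isProper
  obtain ⟨U, hUd, hUpre, hUiso⟩ := hres.isBirational
  haveI := hUiso
  haveI : IrreducibleSpace Y := IsBirational.irreducibleSpace ⟨U, hUd, hUpre, hUiso⟩
  haveI : IsReduced Y := hres.isRegular.isReduced
  haveI : IsIntegral Y := isIntegral_of_irreducibleSpace_of_isReduced Y
  haveI hYsm : Smooth (π ≫ fL) := smooth_of_isRegular_of_perfectField (π ≫ fL) hres.isRegular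
  haveI hYpr : IsProper (π ≫ fL) := inferInstance
  have hUξ : genericPoint XL ∈ U := by
    haveI : Nonempty U := (hUd.nonempty).to_subtype
    exact ((genericPoint_spec XL).mem_open_set_iff U.isOpen).mpr (by simpa using ‹Nonempty U›)
  -- ### Step 3: spread `π` out over a finitely generated `K`-subalgebra `R ⊆ L`
  obtain ⟨R, _, _, ψ, YR, G, πR, ℓ, hψ, hRft, hGsep, hGlft, hGqc, hℓ₁, hℓ₂, hsq⟩ :=
    Literature.AlgebraicGeometry.Limits.exists_isPullback_whisker_of_hom_tensorObj (K := K) (B := L)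
      X₀ π
  haveI := hRft; haveI := hGsep; haveI := hGlft; haveI := hGqc
  haveI : IsDomain R := Function.Injective.isDomain ψ.toRingHom hψ
  haveI : IsNoetherianRing R := Algebra.FiniteType.isNoetherianRing K R
  let XR : Scheme.{0} := (X₀ ⊗ specOver K R).left
  let fstR : XR ⟶ X := pullback.fst X₀.hom (specOver K R).hom
  let fR : XR ⟶ Spec (.of R) := pullback.snd X₀.hom (specOver K R).hom
  let iψ : Spec (.of L) ⟶ Spec (.of R) := Spec.map (CommRingCat.ofHom ψ.toRingHom)
  have hiψ : iψ ≫ (specOver K R).hom = (specOver K L).hom := by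
    change Spec.map _ ≫ Spec.map _ = Spec.map _
    rw [← Spec.map_comp, ← CommRingCat.ofHom_comp]
    congr 2
    exact ψ.comp_algebraMap
  -- `X_R` is integral (geometric integrality over `K`, `R` a domain) and Noetherian
  haveI : Subsingleton ↥(Spec (CommRingCat.of K)) := inferInstanceAs (Subsingleton (PrimeSpectrum K))
  haveI : Flat X₀.hom := inferInstance
  haveI : UniversallyOpen X₀.hom := inferInstance
  haveI : GeometricallyIntegral X₀.hom := hGI
  haveI : IsIntegral (specOver K R).left := inferInstanceAs (IsIntegral (Spec (CommRingCat.of R)))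
  haveI : IsLocallyNoetherian (specOver K R).left :=
    inferInstanceAs (IsLocallyNoetherian (Spec (CommRingCat.of R)))
  haveI : IsIntegral XR := inferInstanceAs (IsIntegral (pullback X₀.hom (specOver K R).hom))
  haveI : IsNoetherian XR := Literature.AlgebraicGeometry.Limits.isNoetherian_of_locallyOfFiniteType fR
  -- the square `X_L → X_R` over `Spec L → Spec R`
  have hsqℓ : IsPullback ℓ fL fR iψ := by
    refine IsPullback.of_right (h₁₂ := fstR) (v₁₃ := f) (h₂₂ := (specOver K R).hom) ?_ hℓ₂
      (IsPullback.of_hasPullback X₀.hom (specOver K R).hom)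
    rw [hℓ₁, hiψ]
    exact IsPullback.of_hasPullback X₀.hom (specOver K L).hom
  -- `ℓ` maps the generic point to the generic point
  haveI : Nonempty ↥X₀.left := inferInstanceAs (Nonempty X)
  haveI : Surjective X₀.hom := ⟨fun y => ⟨Nonempty.some inferInstance, Subsingleton.elim _ _⟩⟩
  haveI : Surjective fR := inferInstance
  have hfRξ : fR (genericPoint XR) = (⊥ : PrimeSpectrum R) := by
    have := ProductDescent.Birth.apply_genericPoint_of_surjective fR
    rw [genericPoint_eq_bot_of_affine] at this
    exact this
  have hℓξ : ℓ (genericPoint XL) = genericPoint XR := by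
    -- the generic point of `X_R` lies over the generic point of `Spec R`, which is hit by `Spec L`
    haveI : Subsingleton ↥(Spec (CommRingCat.of L)) := inferInstanceAs (Subsingleton (PrimeSpectrum L))
    let ηL : ↥(Spec (CommRingCat.of L)) := Nonempty.some inferInstance
    have hη : iψ ηL = (⊥ : PrimeSpectrum R) := by
      apply PrimeSpectrum.ext
      change Ideal.comap ψ.toRingHom ηL.asIdeal = ⊥
      haveI : Subsingleton (PrimeSpectrum L) := inferInstance
      have : ηL.asIdeal = ⊥ := by
        have h := Subsingleton.elim ηL (⟨⊥, Ideal.isPrime_bot⟩ : PrimeSpectrum L)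
        rw [h]
      rw [this]
      exact Ideal.comap_bot_of_injective _ hψ
    obtain ⟨z, hz, -⟩ := Scheme.Pullback.exists_preimage_pullback (f := fR) (g := iψ)
      (genericPoint XR) ηL (by rw [hfRξ, hη])
    have hz' : ℓ (hsqℓ.isoPullback.inv z) = genericPoint XR := by
      rw [← Scheme.Hom.comp_apply, IsPullback.isoPullback_inv_fst]; exact hz
    have h1 : ℓ (genericPoint XL) ⤳ genericPoint XR := by
      rw [← hz']
      exact ((genericPoint_spec XL).specializes trivial).map ℓ.continuous
    exact (h1.antisymm ((genericPoint_spec XR).specializes trivial)).eq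
  -- ### Step 4: `G` is an isomorphism over a non-empty open `W ⊆ X_R`
  haveI : LocallyOfFinitePresentation G := locallyOfFinitePresentation_of_isLocallyNoetherian' G
  haveI : QuasiSeparated G := inferInstance
  haveI := isIso_pullback_snd_fromSpecStalk_genericPoint_of_isPullback hsq hℓξ U hUξ
  obtain ⟨W, hWne, hWiso⟩ :=
    exists_isIso_morphismRestrict_of_isIso_pullback_snd_fromSpecStalk G (x := genericPoint XR) rfl
  haveI := hWiso
  have hξW : genericPoint XR ∈ W :=
    ((genericPoint_spec XR).mem_open_set_iff W.isOpen).mpr (by simpa using hWne)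
  -- ### Step 5: the fraction field `F` of `R`, the model `P = (Y_R → Spec R)`, and descent from `L`
  let qR : YR ⟶ Spec (.of R) := G ≫ fR
  haveI : IsSeparated qR := inferInstance
  haveI : LocallyOfFiniteType qR := inferInstance
  haveI : QuasiCompact qR := inferInstance
  let P : SchemeOver R := Over.mk qR
  haveI : QuasiCompact P.hom := ‹QuasiCompact qR›
  haveI : IsSeparated P.hom := ‹IsSeparated qR›
  haveI : QuasiSeparated P.hom := inferInstance
  haveI : LocallyOfFiniteType P.hom := ‹LocallyOfFiniteType qR›
  haveI : LocallyOfFinitePresentation P.hom := locallyOfFinitePresentation_of_isLocallyNoetherian' qR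
  -- `Y = Y_R ×_R Spec L`
  have hsqY : IsPullback πR (π ≫ fL) qR iψ := hsq.paste_vert hsqℓ
  -- the fraction field
  let F : Type := FractionRing R
  letI : Algebra R L := ψ.toRingHom.toAlgebra
  have hψ' : Function.Injective (algebraMap R L) := hψ
  let φ : F →+* L := IsFractionRing.lift hψ'
  let iF : Spec (.of F) ⟶ Spec (.of R) := Spec.map (CommRingCat.ofHom (algebraMap R F))
  let jF : Spec (.of L) ⟶ Spec (.of F) := Spec.map (CommRingCat.ofHom φ)
  have hjF : jF ≫ iF = iψ := by
    change Spec.map _ ≫ Spec.map _ = Spec.map _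
    rw [← Spec.map_comp, ← CommRingCat.ofHom_comp]
    congr 2
    exact RingHom.ext fun x => IsFractionRing.lift_algebraMap hψ' x
  let YF : Scheme.{0} := pullback P.hom iF
  let qF : YF ⟶ Spec (.of F) := pullback.snd P.hom iF
  -- `Y → Y_F` is cartesian over `Spec L → Spec F`
  let m : Y ⟶ YF := pullback.lift πR ((π ≫ fL) ≫ jF)
    (by rw [Category.assoc, hjF]; exact hsqY.w)
  have hsqYF : IsPullback m (π ≫ fL) qF jF := by
    have outer : IsPullback (m ≫ pullback.fst P.hom iF) (π ≫ fL) qR (jF ≫ iF) := by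
      rw [pullback.lift_fst, hjF]; exact hsqY
    exact outer.of_right (pullback.lift_snd _ _ _) (IsPullback.of_hasPullback P.hom iF)
  -- `Spec L → Spec F` is flat, surjective and quasi-compact; descend smoothness and properness
  haveI : Subsingleton ↥(Spec (CommRingCat.of F)) := inferInstanceAs (Subsingleton (PrimeSpectrum F))
  haveI : Subsingleton ↥(Spec (CommRingCat.of L)) := inferInstanceAs (Subsingleton (PrimeSpectrum L))
  haveI : Nonempty ↥(Spec (CommRingCat.of L)) := inferInstanceAs (Nonempty (PrimeSpectrum L))
  haveI : Flat jF := by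
    letI : Algebra F L := φ.toAlgebra
    haveI hflat : Module.Flat F L := inferInstance
    rw [show jF = Spec.map (CommRingCat.ofHom (algebraMap F L)) from rfl, Flat.SpecMap_iff,
      CommRingCat.hom_ofHom]
    exact RingHom.flat_algebraMap_iff.mpr hflat
  haveI : Surjective jF := inferInstance
  have hQ : (@Surjective ⊓ @Flat ⊓ @QuasiCompact : MorphismProperty Scheme.{0}) jF :=
    ⟨⟨‹Surjective jF›, ‹Flat jF›⟩, inferInstance⟩
  haveI hsmF : Smooth qF :=
    MorphismProperty.of_isPullback_of_descendsAlong (P := @Smooth) hsqYF.flip hQ hYsm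
  haveI : UniversallyClosed qF :=
    MorphismProperty.of_isPullback_of_descendsAlong (P := @UniversallyClosed) hsqYF.flip hQ
      inferInstance
  haveI : IsSeparated qF := inferInstance
  haveI : LocallyOfFiniteType qF := inferInstance
  haveI hprF : IsProper qF := ⟨⟩
  -- `Y_F` is integral (`Y → Y_F` is flat and surjective)
  haveI : Flat m := MorphismProperty.of_isPullback (P := @Flat) hsqYF.flip ‹Flat jF›
  haveI : Surjective m :=
    MorphismProperty.of_isPullback (P := @Surjective) hsqYF.flip ‹Surjective jF›
  haveI : IsReduced YF := Literature.AlgebraicGeometry.Morphisms.isReduced_of_flat_of_surjective m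
  haveI : IrreducibleSpace YF := Function.Surjective.irreducibleSpace m.continuous m.surjective
  haveI : IsIntegral YF := isIntegral_of_irreducibleSpace_of_isReduced YF
  -- ### Step 6: smoothness and properness spread from `F = Frac R` to some `D(t)`
  obtain ⟨s₂, hs₂S, hs₂⟩ := LocApprox.exists_forall_smooth_snd (nonZeroDivisors R) F P hsmF
  let E : SchemeOver F := (Over.pullback (specOver R F).hom).obj P
  haveI : IsProper E.hom := hprF
  haveI : IsIntegral E.left := ‹IsIntegral YF›
  obtain ⟨Yc, a, hYc, ha⟩ := exists_proper_generic_cover P E (Iso.refl _)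
  haveI := hYc
  haveI : QuasiCompact Yc.hom := inferInstance
  haveI : QuasiSeparated Yc.hom := inferInstance
  obtain ⟨s₁, g, hg⟩ := LocApprox.exists_whiskerLeft_comp_eq F (S := nonZeroDivisors R) (P := Yc) a
  let t : Idx (nonZeroDivisors R) := ⟨s₁.val * s₂, mul_mem s₁.mem hs₂S⟩
  have ht₁ : t ≤ s₁ := Idx.le_iff.mpr (dvd_mul_right _ _)
  have ht₂ : s₂ ∣ t.val := dvd_mul_left _ _
  haveI hsmt : Smooth (pullback.snd P.hom ((baseDiagram (nonZeroDivisors R)).obj t).hom) :=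
    hs₂ t.val ht₂ (loc (nonZeroDivisors R) t)
  haveI : Flat (pullback.snd P.hom ((baseDiagram (nonZeroDivisors R)).obj t).hom) := inferInstance
  haveI : IsSeparated (pullback.snd P.hom ((baseDiagram (nonZeroDivisors R)).obj t).hom) :=
    inferInstance
  have hgt : (Yc ◁ leg (nonZeroDivisors R) F t) ≫ ((Yc ◁ (baseDiagram _).map (homOfLE ht₁)) ≫ g) = a := by
    rw [← MonoidalCategory.whiskerLeft_comp_assoc, leg_comp_map, hg]
  have ha' : Function.Surjective (lift ((Yc ◁ leg (nonZeroDivisors R) F t) ≫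
      ((Yc ◁ (baseDiagram _).map (homOfLE ht₁)) ≫ g)) (snd Yc (specOver R F))).left := by
    rw [hgt]; exact ha
  haveI hprt : IsProper (pullback.snd P.hom ((baseDiagram (nonZeroDivisors R)).obj t).hom) :=
    isProper_snd_of_generic_cover (B := F) le_rfl Yc P t _ ha'
  -- the stage `Spec R[1/t] ⊆ Spec R`
  let Rt : Type := Localization.Away t.val
  let it : Spec (.of Rt) ⟶ Spec (.of R) := Spec.map (CommRingCat.ofHom (algebraMap R Rt))
  let qt : pullback qR it ⟶ Spec (.of Rt) := pullback.snd qR it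
  haveI : Smooth qt := hsmt
  haveI : IsProper qt := hprt
  have ht0 : t.val ≠ 0 := nonZeroDivisors.ne_zero t.mem
  -- ### Step 7: a `K`-rational closed point `a ∈ D(t)` over which `W` has a point
  haveI : UniversallyOpen fR := inferInstance
  let O : Set (PrimeSpectrum R) := (PrimeSpectrum.basicOpen t.val : Set (PrimeSpectrum R)) ∩
    fR.base '' (W : Set XR)
  have hO : IsOpen O := (PrimeSpectrum.basicOpen t.val).2.inter (fR.isOpenMap _ W.2)
  have hOne : O.Nonempty :=
    ⟨⊥, (PrimeSpectrum.mem_basicOpen _ _).mpr (by simpa using ht0), ⟨genericPoint XR, hξW, hfRξ⟩⟩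
  obtain ⟨x, hxO, hxmax, hbij⟩ := exists_isMaximal_mem_of_isOpen (K := K) (R := R) hO hOne
  haveI := hxmax
  let κ : Type := R ⧸ x.asIdeal
  letI : Field κ := Ideal.Quotient.field x.asIdeal
  have htu : IsUnit (Ideal.Quotient.mk x.asIdeal t.val) := by
    rw [isUnit_iff_ne_zero, Ne, Ideal.Quotient.eq_zero_iff_mem]
    exact (PrimeSpectrum.mem_basicOpen _ _).mp hxO.1
  let lt : Rt →+* κ := IsLocalization.Away.lift t.val htu
  have hlt : lt.comp (algebraMap R Rt) = Ideal.Quotient.mk x.asIdeal :=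
    IsLocalization.Away.lift_comp (x := t.val) htu
  let ct : Spec (.of κ) ⟶ Spec (.of Rt) := Spec.map (CommRingCat.ofHom lt)
  let c₀ : Spec (.of κ) ⟶ Spec (.of R) := ct ≫ it
  have hc₀ : c₀ = Spec.map (CommRingCat.ofHom (Ideal.Quotient.mk x.asIdeal)) := by
    change Spec.map _ ≫ Spec.map _ = _
    rw [← Spec.map_comp, ← CommRingCat.ofHom_comp, hlt]
  haveI : Subsingleton ↥(Spec (CommRingCat.of κ)) := inferInstanceAs (Subsingleton (PrimeSpectrum κ))
  haveI : Nonempty ↥(Spec (CommRingCat.of κ)) := inferInstanceAs (Nonempty (PrimeSpectrum κ))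
  have hc₀x : ∀ p : ↥(Spec (CommRingCat.of κ)), c₀ p = x := by
    intro p
    rw [hc₀]
    apply PrimeSpectrum.ext
    change Ideal.comap (Ideal.Quotient.mk x.asIdeal) p.asIdeal = x.asIdeal
    have hp : p = (⟨⊥, Ideal.isPrime_bot⟩ : PrimeSpectrum κ) := Subsingleton.elim _ _
    rw [hp, ← RingHom.ker_eq_comap_bot, Ideal.mk_ker]
  -- `K ≅ κ(a)`
  have hcK : c₀ ≫ (specOver K R).hom = Spec.map (CommRingCat.ofHom (algebraMap K κ)) := by
    rw [hc₀]
    change Spec.map _ ≫ Spec.map _ = _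
    rw [← Spec.map_comp, ← CommRingCat.ofHom_comp]
    rfl
  let eκ : K ≃+* κ := RingEquiv.ofBijective (algebraMap K κ) hbij
  haveI : IsIso (Spec.map (CommRingCat.ofHom (algebraMap K κ))) :=
    inferInstanceAs (IsIso (Spec.map eκ.toCommRingCatIso.hom))
  haveI : IsIso (c₀ ≫ (specOver K R).hom) := by rw [hcK]; infer_instance
  -- ### Step 8: the fibres over `a`: `G_a : Y_a → X_a ≅ X`
  let Xa : Scheme.{0} := pullback fR c₀
  let ga : Xa ⟶ XR := pullback.fst fR c₀
  let pa : Xa ⟶ Spec (.of κ) := pullback.snd fR c₀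
  let Ya : Scheme.{0} := pullback G ga
  let Ga : Ya ⟶ Xa := pullback.snd G ga
  -- `Y_a → Spec κ(a)` is a base change of `Y_R ×_R R[1/t] → Spec R[1/t]`: smooth and proper
  have hqa : Ga ≫ pa = (pullbackRightPullbackFstIso fR c₀ G).hom ≫
      (pullbackLeftPullbackSndIso qR it ct).inv ≫ pullback.snd qt ct := by
    rw [pullbackLeftPullbackSndIso_inv_snd_snd, pullbackRightPullbackFstIso_hom_snd]
  haveI : Smooth (Ga ≫ pa) := by rw [hqa]; infer_instance
  haveI : IsProper (Ga ≫ pa) := by rw [hqa]; infer_instance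
  haveI : IsSeparated pa := inferInstance
  haveI : IsProper Ga := IsProper.of_comp Ga pa
  have hYareg : Scheme.IsRegular Ya := fun y => isRegularLocalRing_stalk_of_smooth_of_field (Ga ≫ pa) y
  haveI : IsNoetherian Ya :=
    Literature.AlgebraicGeometry.Limits.isNoetherian_of_locallyOfFiniteType (Ga ≫ pa)
  haveI : NoetherianSpace Ya := inferInstance
  -- `G_a` is an isomorphism over the non-empty open `W_a = W ×_{X_R} X_a`
  let Wa : Xa.Opens := ga ⁻¹ᵁ W
  haveI : IsIso (Ga ∣_ Wa) :=
    Literature.AlgebraicGeometry.Morphisms.isIso_morphismRestrict_pullback_snd G ga W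
  obtain ⟨w, hwW, hwx⟩ := hxO.2
  obtain ⟨z, hz, -⟩ := Scheme.Pullback.exists_preimage_pullback (f := fR) (g := c₀) w
    (Nonempty.some inferInstance) (by rw [hc₀x]; exact hwx)
  have hWane : (Wa : Set Xa).Nonempty := ⟨z, show ga z ∈ W by rw [hz]; exact hwW⟩
  -- `X_a ≅ X` (`κ(a) = K`), in particular `X_a` is irreducible
  let toX : Xa ⟶ X := (pullbackLeftPullbackSndIso X₀.hom (specOver K R).hom c₀).hom ≫
    pullback.fst X₀.hom (c₀ ≫ (specOver K R).hom)
  haveI : IsIso toX := inferInstance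
  haveI : IrreducibleSpace Xa :=
    Function.Surjective.irreducibleSpace (inv toX).continuous (inv toX).surjective
  -- ### Step 9: conclude
  exact Scheme.HasResolution.of_iso toX
    (hasResolution_of_isIso_morphismRestrict Ga hYareg Wa hWane)

/-- **SPECIALIZATION: `Res(L) ⇒ Res(K)` for `K` algebraically closed, `L ⊇ K` perfect.** If every
integral separated scheme of finite type over the perfect field `L` has a resolution of
singularities, then so does every integral separated scheme of finite type over the algebraically
closed subfield `K` (reduce to proper `X` by Nagata, `hasResolution_of_forall_proper`, then
`hasResolution_of_isProper_of_integralResOver_extension`). The downward (Lefschetz-principle)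
direction of the crux `PrimeModelTransfer`; the crux itself is the upward direction.
[cite: EGAIV3, Thm. 8.10.5] -/
theorem integralResOver_of_integralResOver_extension (K : Type) [Field K] [IsAlgClosed K]
    (L : Type) [Field L] [Algebra K L] [PerfectField L]
    (hL : ∀ (X : Scheme.{0}) (f : X ⟶ Spec (.of L)), IsSeparated f → LocallyOfFiniteType f →
      QuasiCompact f → IsIntegral X → Scheme.HasResolution X)
    (X : Scheme.{0}) (f : X ⟶ Spec (.of K)) (hs : IsSeparated f) (hl : LocallyOfFiniteType f)
    (hq : QuasiCompact f) (hX : IsIntegral X) : Scheme.HasResolution X :=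
  hasResolution_of_forall_proper K
    (fun Y g _ _ => hasResolution_of_isProper_of_integralResOver_extension K L hL Y g) X f

/-- **Monotonicity of the residual ladder.** Inside a field `K`, let `M₁ ≤ M₂` be subfields with
`M₁` algebraically closed and `M₂` perfect (e.g. both algebraically closed). If every integral
separated scheme of finite type over `M₂` has a resolution, then so does every one over `M₁`
(`integralResOver_of_integralResOver_extension` for the extension `M₁ ⊆ M₂`). For the door-2
tower `A(S) = (𝔽_p(S))^{alg} ∩ K` of `Theorems/UniformComplexityPrimeModelTransferAlgClosureFgTower.lean`
this says `Res(A(S ∪ {t})) ⇒ Res(A(S))`: the residual statements `R_n = Res((𝔽_p(t₁,…,t_n))^{alg})`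
INCREASE in strength with `n`. [folklore] -/
theorem integralResOver_subfield_of_integralResOver_subfield {K : Type} [Field K]
    (M₁ M₂ : Subfield K) (h12 : M₁ ≤ M₂) [IsAlgClosed M₁] [PerfectField M₂]
    (hM₂ : ∀ (X : Scheme.{0}) (f : X ⟶ Spec (.of M₂)), IsSeparated f → LocallyOfFiniteType f →
      QuasiCompact f → IsIntegral X → Scheme.HasResolution X)
    (X : Scheme.{0}) (f : X ⟶ Spec (.of M₁)) (hs : IsSeparated f) (hl : LocallyOfFiniteType f)
    (hq : QuasiCompact f) (hX : IsIntegral X) : Scheme.HasResolution X := by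
  letI : Algebra M₁ M₂ := (Subfield.inclusion h12).toAlgebra
  exact integralResOver_of_integralResOver_extension M₁ M₂ hM₂ X f hs hl hq hX

end Summit.ResolutionOfSingularities.ResolutionOfSingularities.Theorems.PrimeModelTransfer

end
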